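import Mathlib
import HarnessLib

/-!
# `DensityLadder.SeparatedTowerDensityLine` (item stmt-RiemannHypothesis-24918) — the separated
# off-diagonal sum (step (e) of stub S1: Montgomery–Vaughan in its trivial smoothed form)

LINE L57 «sieve sight above the density line» (rh-idea-10 g1), crux K1 `SeparatedTowerDensityLine`,
stub S1 of the registered skeleton `Birth.lean`, step (e) of the mean-value argument (seat memo
`MEANVALUE-SECOND-READ.md` on stmt-RiemannHypothesis-24918).  With a Gaussian weight the
off-diagonal terms of the mean square of a sum over g-SEPARATED real frequencies `γ_j` are
`≪ e^{−(γ_i−γ_j)²L²/2}`, and for each fixed `i` the k-th neighbour of `γ_i` on either side is at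
distance `≥ kg`, so `Σ_{j ≠ i} e^{−c(γ_j−γ_i)²} ≤ 2 Σ_{k≥1} e^{−c g² k²}` (here with `c > 0`
arbitrary; `c = L²/2` in the application).  This is the whole content of "g-separation decoheres
the tower at bounded width `L = K/g`"; no Hilbert inequality is needed.
Cell rh-split, seat rh-split-prover-l57 g0.  RH-free, ζ-free; FRONTIER bookkeeping; nothing here
bears on the truth of RH.
-/

set_option linter.dupNamespace false

noncomputable section

open Filter Set Topology

namespace Summit.RiemannHypothesis.RiemannHypothesis.Theorems.DensityLadderSeparatedTowerOffDiagonal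

/-- The comparison series `Σ_{n ≥ 0} e^{−c g² (n+1)²}` converges (`c > 0`). [folklore] -/
theorem summable_gauss_nat {c g : ℝ} (hc : 0 < c) (hg : 0 < g) :
    Summable fun n : ℕ ↦ Real.exp (-(c * g ^ 2 * ((n : ℝ) + 1) ^ 2)) := by
  set r : ℝ := Real.exp (-(c * g ^ 2)) with hr
  have hr0 : 0 ≤ r := (Real.exp_pos _).le
  have hr1 : r < 1 := Real.exp_lt_one_iff.2 (by rw [neg_lt_zero]; positivity)
  have hgeo : Summable fun n : ℕ ↦ r * r ^ n := (summable_geometric_of_lt_one hr0 hr1).mul_left r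
  refine Summable.of_nonneg_of_le (fun n ↦ (Real.exp_pos _).le) (fun n ↦ ?_) hgeo
  rw [hr, ← Real.exp_nat_mul, ← Real.exp_add, Real.exp_le_exp]
  have h1 : (1 : ℝ) ≤ (n : ℝ) + 1 := by linarith [(Nat.cast_nonneg n : (0 : ℝ) ≤ n)]
  have hcg : 0 < c * g ^ 2 := by positivity
  nlinarith [mul_le_mul_of_nonneg_left h1 (by positivity : (0 : ℝ) ≤ c * g ^ 2 * ((n : ℝ) + 1))]

/-- **One side.** For `g`-separated reals `γ` and a fixed index `i`, the frequencies to the RIGHT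
of `γ_i` satisfy `Σ_{γ_j > γ_i} e^{−c(γ_j−γ_i)²} ≤ Σ_{n≥0} e^{−c g²(n+1)²}` (the map
`j ↦ ⌊(γ_j−γ_i)/g⌋ − 1` is injective and does not increase the terms). [folklore] -/
theorem tsum_gauss_sep_right_le {J : Type} (γ : J → ℝ) {g : ℝ} (hg : 0 < g)
    (hsep : ∀ j j' : J, j ≠ j' → g ≤ |γ j - γ j'|) (i : J) {c : ℝ} (hc : 0 < c) :
    Summable (fun j : {j : J // γ i < γ j} ↦ Real.exp (-(c * (γ j - γ i) ^ 2))) ∧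
    ∑' j : {j : J // γ i < γ j}, Real.exp (-(c * (γ j - γ i) ^ 2)) ≤
      ∑' n : ℕ, Real.exp (-(c * g ^ 2 * ((n : ℝ) + 1) ^ 2)) := by
  set F : ℕ → ℝ := fun n ↦ Real.exp (-(c * g ^ 2 * ((n : ℝ) + 1) ^ 2)) with hF
  have hFs : Summable F := summable_gauss_nat hc hg
  have hF0 : ∀ n, 0 ≤ F n := fun n ↦ (Real.exp_pos _).le
  -- the normalised distances `y_j = (γ_j - γ_i)/g ≥ 1`
  have hy : ∀ j : {j : J // γ i < γ j}, 1 ≤ (γ j - γ i) / g := by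
    intro j
    have hne : (j : J) ≠ i := fun h ↦ by have := j.2; rw [h] at this; exact lt_irrefl _ this
    have h := hsep j i hne
    rw [abs_of_pos (by linarith [j.2])] at h
    rwa [le_div_iff₀ hg, one_mul]
  -- the injection
  set k : {j : J // γ i < γ j} → ℕ := fun j ↦ ⌊(γ j - γ i) / g⌋₊ - 1 with hk
  have hk1 : ∀ j : {j : J // γ i < γ j}, 1 ≤ ⌊(γ j - γ i) / g⌋₊ := fun j ↦
    (Nat.one_le_floor_iff _).2 (hy j)
  have hkval : ∀ j : {j : J // γ i < γ j}, ((k j : ℕ) : ℝ) + 1 = ⌊(γ j - γ i) / g⌋₊ := by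
    intro j
    rw [hk]
    simp only
    rw [Nat.cast_sub (hk1 j)]
    push_cast
    ring
  have hinj : Function.Injective k := by
    intro j j' hjj'
    by_contra hne
    have hne' : (j : J) ≠ j' := fun h ↦ hne (Subtype.ext h)
    have hfloor : ⌊(γ j - γ i) / g⌋₊ = ⌊(γ j' - γ i) / g⌋₊ := by
      have := congrArg (fun n : ℕ ↦ n + 1) hjj'
      simp only [hk] at this
      rwa [Nat.sub_add_cancel (hk1 j), Nat.sub_add_cancel (hk1 j')] at this
    have hs := hsep j j' hne'
    -- the two normalised distances differ by at least 1, so their floors differ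
    rcases le_or_gt (γ j) (γ j') with h | h
    · rw [abs_of_nonpos (by linarith)] at hs
      have h2 : (γ j - γ i) / g + 1 ≤ (γ j' - γ i) / g := by
        rw [div_add_one hg.ne', div_le_div_iff_of_pos_right hg]; linarith
      have h3 := Nat.floor_le_floor h2
      rw [Nat.floor_add_one (by linarith [hy j])] at h3
      omega
    · rw [abs_of_pos (by linarith)] at hs
      have h2 : (γ j' - γ i) / g + 1 ≤ (γ j - γ i) / g := by
        rw [div_add_one hg.ne', div_le_div_iff_of_pos_right hg]; linarith
      have h3 := Nat.floor_le_floor h2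
      rw [Nat.floor_add_one (by linarith [hy j'])] at h3
      omega
  -- termwise comparison
  have hterm : ∀ j : {j : J // γ i < γ j}, Real.exp (-(c * (γ j - γ i) ^ 2)) ≤ F (k j) := by
    intro j
    rw [hF]
    simp only
    rw [hkval j, Real.exp_le_exp, neg_le_neg_iff]
    have hfl : (⌊(γ j - γ i) / g⌋₊ : ℝ) ≤ (γ j - γ i) / g := Nat.floor_le (by linarith [hy j])
    have hfl0 : (0 : ℝ) ≤ ⌊(γ j - γ i) / g⌋₊ := Nat.cast_nonneg _
    have e : c * (γ j - γ i) ^ 2 = c * g ^ 2 * ((γ j - γ i) / g) ^ 2 := by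
      field_simp
    rw [e]
    exact mul_le_mul_of_nonneg_left (pow_le_pow_left₀ hfl0 hfl 2) (by positivity)
  have hcomp : Summable (F ∘ k) := hFs.comp_injective hinj
  have hS : Summable (fun j : {j : J // γ i < γ j} ↦ Real.exp (-(c * (γ j - γ i) ^ 2))) :=
    Summable.of_nonneg_of_le (fun j ↦ (Real.exp_pos _).le) hterm hcomp
  refine ⟨hS, ?_⟩
  calc ∑' j : {j : J // γ i < γ j}, Real.exp (-(c * (γ j - γ i) ^ 2))
      ≤ ∑' j : {j : J // γ i < γ j}, F (k j) := hS.tsum_le_tsum hterm hcomp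
    _ ≤ ∑' n, F n := tsum_comp_le_tsum_of_inj hFs hF0 hinj

/-- **Both sides.** For `g`-separated reals `γ`, a fixed index `i` and `c > 0`:
`Σ_{j ≠ i} e^{−c(γ_j−γ_i)²} ≤ 2 Σ_{n≥0} e^{−c g²(n+1)²}` (written with the `j = i` term set to `0`),
and the family is summable. [folklore] -/
theorem tsum_gauss_sep_le {J : Type} [DecidableEq J] (γ : J → ℝ) {g : ℝ} (hg : 0 < g)
    (hsep : ∀ j j' : J, j ≠ j' → g ≤ |γ j - γ j'|) (i : J) {c : ℝ} (hc : 0 < c) :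
    Summable (fun j : J ↦ if j = i then (0 : ℝ) else Real.exp (-(c * (γ j - γ i) ^ 2))) ∧
    ∑' j : J, (if j = i then (0 : ℝ) else Real.exp (-(c * (γ j - γ i) ^ 2))) ≤
      2 * ∑' n : ℕ, Real.exp (-(c * g ^ 2 * ((n : ℝ) + 1) ^ 2)) := by
  classical
  -- right side
  obtain ⟨hRs, hR⟩ := tsum_gauss_sep_right_le γ hg hsep i hc
  -- left side = right side for the reflected frequencies `-γ`
  have hsep' : ∀ j j' : J, j ≠ j' → g ≤ |(-γ j) - (-γ j')| := by
    intro j j' h; rw [show (-γ j) - (-γ j') = -(γ j - γ j') by ring, abs_neg]; exact hsep j j' h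
  obtain ⟨hLs0, hL0⟩ := tsum_gauss_sep_right_le (fun j ↦ -γ j) hg hsep' i hc
  -- transport the left side to the subtype `{j // γ j < γ i}`
  set e : {j : J // γ j < γ i} ≃ {j : J // (fun j ↦ -γ j) i < (fun j ↦ -γ j) j} :=
    Equiv.subtypeEquivRight (fun j ↦ by simp only [neg_lt_neg_iff]) with he
  have hLs : Summable (fun j : {j : J // γ j < γ i} ↦ Real.exp (-(c * (γ j - γ i) ^ 2))) := by
    have h := (e.summable_iff (f := fun j : {j : J // (fun j ↦ -γ j) i < (fun j ↦ -γ j) j} ↦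
      Real.exp (-(c * ((fun j ↦ -γ j) j - (fun j ↦ -γ j) i) ^ 2)))).2 hLs0
    refine h.congr fun j ↦ ?_
    simp only [Function.comp_apply, he, Equiv.subtypeEquivRight_apply_coe]
    ring_nf
  have hL : ∑' j : {j : J // γ j < γ i}, Real.exp (-(c * (γ j - γ i) ^ 2)) ≤
      ∑' n : ℕ, Real.exp (-(c * g ^ 2 * ((n : ℝ) + 1) ^ 2)) := by
    have h := Equiv.tsum_eq e (fun j : {j : J // (fun j ↦ -γ j) i < (fun j ↦ -γ j) j} ↦
      Real.exp (-(c * ((fun j ↦ -γ j) j - (fun j ↦ -γ j) i) ^ 2)))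
    rw [← h] at hL0
    refine le_of_eq_of_le ?_ hL0
    refine tsum_congr fun j ↦ ?_
    simp only [he, Equiv.subtypeEquivRight_apply_coe]
    ring_nf
  -- the function as a sum of two indicators
  set h : J → ℝ := fun j ↦ if j = i then (0 : ℝ) else Real.exp (-(c * (γ j - γ i) ^ 2)) with hh
  set R : Set J := {j | γ i < γ j} with hRdef
  set Lf : Set J := {j | γ j < γ i} with hLdef
  have hsplit : ∀ j, h j = R.indicator (fun j ↦ Real.exp (-(c * (γ j - γ i) ^ 2))) j +
      Lf.indicator (fun j ↦ Real.exp (-(c * (γ j - γ i) ^ 2))) j := by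
    intro j
    by_cases hji : j = i
    · subst hji
      simp [hh, hRdef, hLdef]
    · have hne : γ j ≠ γ i := by
        intro e
        have := hsep j i hji
        rw [e, sub_self, abs_zero] at this
        linarith
      rcases lt_or_gt_of_ne hne with hlt | hgt
      · have h1 : j ∉ R := fun hr ↦ by simp [hRdef] at hr; linarith
        have h2 : j ∈ Lf := hlt
        simp [hh, hji, indicator_of_notMem h1, indicator_of_mem h2]
      · have h1 : j ∈ R := hgt
        have h2 : j ∉ Lf := fun hl ↦ by simp [hLdef] at hl; linarith
        simp [hh, hji, indicator_of_mem h1, indicator_of_notMem h2]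
  have hRind : Summable (R.indicator fun j ↦ Real.exp (-(c * (γ j - γ i) ^ 2))) := by
    rw [← summable_subtype_iff_indicator]; exact hRs
  have hLind : Summable (Lf.indicator fun j ↦ Real.exp (-(c * (γ j - γ i) ^ 2))) := by
    rw [← summable_subtype_iff_indicator]; exact hLs
  have hfun : h = fun j ↦ R.indicator (fun j ↦ Real.exp (-(c * (γ j - γ i) ^ 2))) j +
      Lf.indicator (fun j ↦ Real.exp (-(c * (γ j - γ i) ^ 2))) j := funext hsplit
  refine ⟨by rw [hfun]; exact hRind.add hLind, ?_⟩
  rw [hfun, hRind.tsum_add hLind, ← tsum_subtype, ← tsum_subtype]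
  have hR' : ∑' x : ↥R, Real.exp (-(c * (γ x - γ i) ^ 2)) ≤
      ∑' n : ℕ, Real.exp (-(c * g ^ 2 * ((n : ℝ) + 1) ^ 2)) := hR
  have hL' : ∑' x : ↥Lf, Real.exp (-(c * (γ x - γ i) ^ 2)) ≤
      ∑' n : ℕ, Real.exp (-(c * g ^ 2 * ((n : ℝ) + 1) ^ 2)) := hL
  linarith

end Summit.RiemannHypothesis.RiemannHypothesis.Theorems.DensityLadderSeparatedTowerOffDiagonal

end
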